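import Literature.Probability.RandomPlanarGeometry.SAWRatioLimit
import Mathlib.Analysis.SpecialFunctions.Pow.Real
import HarnessLib

/-!
# Kesten's ratio rate, upper side with exponent `1/4`, from sub-exponential envelopes (abstract lemma)

Topic `Literature/Probability/RandomPlanarGeometry` (continues `SAWRatioLimit.lean`: Kesten's iteration lemmas
`Zd.kesten_iter_forward`, `Zd.kesten_prod_ge`; companion of the lane's `SAWKestenRatioExplicit.lean`, whose
`KestenRate.upper_dev` assumes the walk-type lower envelope `μ^n ≤ c_n`).

Source: N. Madras, G. Slade, *The Self-Avoiding Walk* (1993), Lemma 7.3.1 (proof) and §7.5, eq. (7.5.2) (Kesten 1963: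
`c_{N+2}(0,x)/c_N(0,x) − μ² ≤ K N^{-1/4}`).  ABSTRACT lemma on a positive sequence `a`: Kesten's inequality (7.3.3) for all
`n ≥ 1`, the envelopes `e^{-c√n} μ^n ≤ a_n ≤ e^{C√(n+1)} μ^n`, give `a_{N+2}/a_N − μ² ≤ K N^{-1/4}` (`N ≥ 1`).

## What is here (namespace `Literature.Probability.RandomPlanarGeometry.SAW.Zd.KestenRateUpper`)

* `upper_dev_env` — forward product bound with a sub-exponential LOWER envelope;
* **`upper_rate_fourthRoot`** — the abstract `1/4`-rate lemma.
-/

noncomputable section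

open Filter Topology Finset

namespace Literature.Probability.RandomPlanarGeometry.SAW.Zd

namespace KestenRateUpper

/-- **Upper deviation with envelopes** (quantitative Lemma 7.3.1): if `φ_N ≥ μ² + u` and `M·B ≤ uN/2` then
`(μ² + u/2)^M e^{-g(N)} μ^N ≤ a_{N+2M} ≤ e^{G(N+2M)} μ^{N+2M}`, i.e. `M log(1 + u/(2μ²)) ≤ G(N+2M) + g(N)`.
[cite: MadrasSlade1993, Lemma 7.3.1 (proof, quantitative form)] -/
theorem upper_dev_env {a : ℕ → ℝ} {μ B u : ℝ} {G g : ℕ → ℝ} (ha : ∀ n, 0 < a n) (hμ : 0 < μ)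
    (hB : 0 ≤ B) (hK : ∀ n : ℕ, 1 ≤ n → a (n + 2) / a n - B / n ≤ a (n + 4) / a (n + 2))
    (hlo : ∀ n, Real.exp (-g n) * μ ^ n ≤ a n) (hhi : ∀ n, a n ≤ Real.exp (G n) * μ ^ n)
    {N M : ℕ} (hN : 1 ≤ N) (hu : 0 < u) (hdev : μ ^ 2 + u ≤ a (N + 2) / a N)
    (hM : (M : ℝ) * B ≤ u * N / 2) :
    (M : ℝ) * Real.log (1 + u / (2 * μ ^ 2)) ≤ G (N + 2 * M) + g N := by
  have hN0 : (0 : ℝ) < N := by exact_mod_cast hN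
  set q : ℝ := μ ^ 2 + u / 2 with hq
  have hq0 : 0 ≤ q := by positivity
  have hK' : ∀ n : ℕ, 1 ≤ n → (fun n => a (n + 2) / a n) n - B / n ≤ (fun n => a (n + 2) / a n) (n + 2) := by
    intro n hn; simpa [add_assoc] using hK n hn
  have hiter := kesten_iter_forward (φ := fun n => a (n + 2) / a n) (N₁ := 1) hB hK' hN hN
  have hstep : ∀ k < M, q ≤ a (N + 2 * k + 2) / a (N + 2 * k) := by
    intro k hk
    have h1 := hiter k
    have h2 : (k : ℝ) * B / N ≤ u / 2 := by
      rw [div_le_iff₀ hN0]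
      have : (k : ℝ) * B ≤ M * B := mul_le_mul_of_nonneg_right (by exact_mod_cast hk.le) hB
      linarith
    have e : a (N + 2 * k + 2) / a (N + 2 * k) = (fun n => a (n + 2) / a n) (N + 2 * k) := rfl
    rw [e]
    linarith
  have hprod := kesten_prod_ge ha (n := N) (M := M) hq0 hstep
  have h1 : q ^ M * (Real.exp (-g N) * μ ^ N) ≤ Real.exp (G (N + 2 * M)) * μ ^ (N + 2 * M) :=
    calc q ^ M * (Real.exp (-g N) * μ ^ N) ≤ q ^ M * a N := mul_le_mul_of_nonneg_left (hlo N) (pow_nonneg hq0 M)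
      _ ≤ a (N + 2 * M) := hprod
      _ ≤ _ := hhi _
  have h2 : (q / μ ^ 2) ^ M ≤ Real.exp (G (N + 2 * M) + g N) := by
    rw [div_pow, div_le_iff₀ (by positivity), ← pow_mul, Real.exp_add]
    have e : μ ^ (N + 2 * M) = μ ^ (2 * M) * μ ^ N := by rw [pow_add, mul_comm]
    rw [e] at h1
    have h1' : q ^ M * Real.exp (-g N) * μ ^ N ≤ Real.exp (G (N + 2 * M)) * μ ^ (2 * M) * μ ^ N := by
      rw [mul_assoc, mul_assoc]; exact h1
    have h3 := le_of_mul_le_mul_right h1' (pow_pos hμ N)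
    have h4 : q ^ M = q ^ M * Real.exp (-g N) * Real.exp (g N) := by
      rw [mul_assoc, ← Real.exp_add, neg_add_cancel, Real.exp_zero, mul_one]
    rw [h4]
    calc q ^ M * Real.exp (-g N) * Real.exp (g N) ≤ Real.exp (G (N + 2 * M)) * μ ^ (2 * M) * Real.exp (g N) :=
          mul_le_mul_of_nonneg_right h3 (Real.exp_pos _).le
      _ = Real.exp (G (N + 2 * M)) * Real.exp (g N) * μ ^ (2 * M) := by ring
  have hr : q / μ ^ 2 = 1 + u / (2 * μ ^ 2) := by rw [hq]; field_simp
  have hr0 : 0 < q / μ ^ 2 := by rw [hr]; positivity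
  have h3 := Real.log_le_log (pow_pos hr0 M) h2
  rw [Real.log_exp, Real.log_pow, hr] at h3
  exact h3

/-! ### Elementary real lemmas -/

/-- `x ≤ K` from `x^k ≤ K`, `K ≥ 1`, `x ≥ 0`, `k ≥ 1`. [folklore] -/
private theorem le_of_pow_le' {x K : ℝ} {k : ℕ} (hk : 1 ≤ k) (_hx : 0 ≤ x) (hK : 1 ≤ K) (h : x ^ k ≤ K) : x ≤ K := by
  by_contra hc
  push Not at hc
  have h1 : 1 < x := by linarith
  have : K < x ^ k := by
    calc K < x := hc
      _ = x ^ 1 := (pow_one x).symm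
      _ ≤ x ^ k := pow_le_pow_right₀ h1.le hk
  linarith

/-- `log(1+x) ≥ x/2` on `[0,1]`. [folklore] -/
private theorem half_le_log_one_add {x : ℝ} (hx0 : 0 ≤ x) (hx1 : x ≤ 1) : x / 2 ≤ Real.log (1 + x) := by
  have h := Real.one_sub_inv_le_log_of_pos (show 0 < 1 + x by linarith)
  have h2 : x / 2 ≤ 1 - (1 + x)⁻¹ := by
    have e : 1 - (1 + x)⁻¹ = x / (1 + x) := by field_simp; ring
    rw [e]
    exact div_le_div_of_nonneg_left hx0 (by linarith) (by linarith)
  linarith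

/-- `log(1+x) ≥ 1/2` for `x ≥ 1`. [folklore] -/
private theorem half_le_log_one_add' {x : ℝ} (hx1 : 1 ≤ x) : 1 / 2 ≤ Real.log (1 + x) := by
  have h2 : Real.log 2 ≤ Real.log (1 + x) := Real.log_le_log (by norm_num) (by linarith)
  have h3 : (1 : ℝ) / 2 ≤ Real.log 2 := by
    have := Real.one_sub_inv_le_log_of_pos (show (0 : ℝ) < 2 by norm_num)
    norm_num at this ⊢
    linarith
  linarith

/-- The fourth root: `t = N^{1/4}` satisfies `t ≥ 1`, `t⁴ = N`, `√N = t²`, `N^{-1/4} = t⁻¹` for `N ≥ 1`. [folklore] -/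
private theorem fourthRoot_facts {N : ℝ} (hN : 1 ≤ N) :
    0 < N ^ ((1 : ℝ) / 4) ∧ 1 ≤ N ^ ((1 : ℝ) / 4) ∧ (N ^ ((1 : ℝ) / 4)) ^ 4 = N ∧
      Real.sqrt N = (N ^ ((1 : ℝ) / 4)) ^ 2 ∧ N ^ (-(1 : ℝ) / 4) = (N ^ ((1 : ℝ) / 4))⁻¹ := by
  have hN0 : 0 < N := by linarith
  have h4 : (N ^ ((1 : ℝ) / 4)) ^ 4 = N := by
    rw [← Real.rpow_natCast, ← Real.rpow_mul hN0.le]; norm_num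
  refine ⟨Real.rpow_pos_of_pos hN0 _, Real.one_le_rpow hN (by norm_num), h4, ?_, ?_⟩
  · have : N = ((N ^ ((1 : ℝ) / 4)) ^ 2) ^ 2 := by rw [← pow_mul]; exact h4.symm
    conv_lhs => rw [this]
    exact Real.sqrt_sq (by positivity)
  · rw [show (-(1 : ℝ) / 4) = -((1 : ℝ) / 4) by ring, Real.rpow_neg hN0.le]

/-- Algebra. [folklore] -/
private theorem aux1 (u N B μ : ℝ) (hB : 0 < B) (hμ : 0 < μ) :
    u * N / (4 * B) * (u / (2 * μ ^ 2)) = u ^ 2 * N / (8 * B * μ ^ 2) := by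
  field_simp
  ring

/-- Algebra. [folklore] -/
private theorem aux2 (u N B : ℝ) (hB : 0 < B) : u * N / (2 * B) / 2 = u * N / (4 * B) := by
  field_simp
  ring

/-- Algebra. [folklore] -/
private theorem aux3 (u N B : ℝ) (hB : 0 < B) : 2 * (u * N / (2 * B)) = u * N / B := by
  field_simp

/-- Algebra. [folklore] -/
private theorem aux4 (u N B : ℝ) (hB : 0 < B) : u * N / (2 * B) * B = u * N / 2 := by
  field_simp

/-! ### The abstract `1/4`-rate lemma -/

/-- **Upper deviation rate `N^{-1/4}` from the envelopes.** For a positive sequence `a` with Kesten's inequality (7.3.3)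
(constant `B ≥ 1`, all `n ≥ 1`) and envelopes `e^{-c√n} μ^n ≤ a_n ≤ e^{C√(n+1)} μ^n` (`μ ≥ 1`): there is `K` with
`u ≤ K N^{-1/4}` whenever `N ≥ 1`, `u > 0`, `μ² + u ≤ a_{N+2}/a_N`.
[cite: MadrasSlade1993, §7.5, eq. (7.5.2) (Kesten 1963: the exponent 1/4); Lemma 7.3.1] -/
theorem upper_rate_fourthRoot {a : ℕ → ℝ} {μ B c C : ℝ} (ha : ∀ n, 0 < a n) (hμ : 1 ≤ μ)
    (hB1 : 1 ≤ B) (hc : 0 ≤ c) (hC : 0 ≤ C)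
    (hK : ∀ n : ℕ, 1 ≤ n → a (n + 2) / a n - B / n ≤ a (n + 4) / a (n + 2))
    (hlo : ∀ n : ℕ, Real.exp (-(c * Real.sqrt n)) * μ ^ n ≤ a n)
    (hhi : ∀ n : ℕ, a n ≤ Real.exp (C * Real.sqrt ((n : ℝ) + 1)) * μ ^ n) :
    ∃ K : ℝ, ∀ N : ℕ, 1 ≤ N → ∀ u : ℝ, 0 < u → μ ^ 2 + u ≤ a (N + 2) / a N →
      u ≤ K * (N : ℝ) ^ (-(1 : ℝ) / 4) := by
  have hμ0 : 0 < μ := by linarith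
  have hB0 : 0 < B := by linarith
  -- constants
  set C₂ : ℝ := 1 / 2 + 3 * C + c with hC₂
  set K₁ : ℝ := (8 * B * C₂) ^ 2 with hK₁
  set C₃ : ℝ := 2 * (2 * μ * C + c) with hC₃
  set K₂ : ℝ := 8 * B * μ ^ 2 * C₃ with hK₂
  set K : ℝ := max (max 1 K₁) (max K₂ (2 * B)) with hKdef
  have hK1 : 1 ≤ K := le_trans (le_max_left _ _) (le_max_left _ _)
  have hK₁le : K₁ ≤ K := le_trans (le_max_right _ _) (le_max_left _ _)
  have hK₂le : K₂ ≤ K := le_trans (le_max_left _ _) (le_max_right _ _)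
  have h2Ble : 2 * B ≤ K := le_trans (le_max_right _ _) (le_max_right _ _)
  refine ⟨K, fun N hN u hu hdev => ?_⟩
  have hNr : (1 : ℝ) ≤ N := by exact_mod_cast hN
  have hN0 : (0 : ℝ) < N := by linarith
  obtain ⟨ht0, ht1, ht4, hsqrt, htinv⟩ := fourthRoot_facts hNr
  set t : ℝ := (N : ℝ) ^ ((1 : ℝ) / 4) with htdef
  rw [htinv, ← div_eq_mul_inv, le_div_iff₀ ht0]
  have hut0 : 0 ≤ u * t := by positivity
  set s : ℝ := Real.sqrt N with hsdef
  have hs1 : 1 ≤ s := by rw [hsqrt]; exact one_le_pow₀ ht1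
  have hs0 : 0 < s := by linarith
  have hsN : s ^ 2 = N := by rw [hsdef]; exact Real.sq_sqrt hN0.le
  -- block count `y = uN/(2B)`
  set y : ℝ := u * N / (2 * B) with hy
  have hy0 : 0 ≤ y := by positivity
  by_cases hsmall : y < 1
  · -- `u N < 2B`: `u t · t³ ≤ 2B`
    have h1 : u * N < 2 * B := by rw [hy, div_lt_iff₀ (by positivity)] at hsmall; linarith
    have ht3 : 1 ≤ t ^ 3 := one_le_pow₀ ht1
    have h2 : u * t * t ^ 3 ≤ 2 * B := by
      have : u * t * t ^ 3 = u * N := by rw [← ht4]; ring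
      rw [this]; exact h1.le
    have h3 : u * t * 1 ≤ u * t * t ^ 3 := mul_le_mul_of_nonneg_left ht3 hut0
    have : u * t ≤ 2 * B := by linarith
    exact this.trans h2Ble
  · push Not at hsmall
    set M : ℕ := ⌊y⌋₊ with hMdef
    have hMle : (M : ℝ) ≤ y := Nat.floor_le hy0
    have hMlt : y < M + 1 := Nat.lt_floor_add_one y
    have hM1 : (1 : ℝ) ≤ M := by
      have := Nat.le_floor (show ((1 : ℕ) : ℝ) ≤ y by exact_mod_cast hsmall)
      exact_mod_cast this
    have hMy : y / 2 ≤ M := by linarith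
    have hMB : (M : ℝ) * B ≤ u * N / 2 := by
      have := mul_le_mul_of_nonneg_right hMle hB0.le
      rw [hy, aux4 u N B hB0] at this
      exact this
    -- the deviation bound
    have hdevb := upper_dev_env (G := fun n => C * Real.sqrt ((n : ℝ) + 1)) (g := fun n => c * Real.sqrt n)
      ha hμ0 hB0.le hK hlo hhi hN hu hdev hMB
    set x : ℝ := u / (2 * μ ^ 2) with hx
    have hx0 : 0 < x := by positivity
    -- `N + 2M + 1 ≤ N (2 + u/B)` and hence `√(N+2M+1) ≤ s √(2 + u/B)`
    have hNM : ((N + 2 * M : ℕ) : ℝ) + 1 ≤ N * (2 + u / B) := by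
      push_cast
      have h2M : 2 * (M : ℝ) ≤ u * N / B := by
        have : 2 * (M : ℝ) ≤ 2 * y := by linarith
        rw [hy, aux3 u N B hB0] at this
        exact this
      have e2 : (N : ℝ) * (2 + u / B) = 2 * N + u * N / B := by ring
      rw [e2]; linarith
    have hsqrtNM : Real.sqrt (((N + 2 * M : ℕ) : ℝ) + 1) ≤ s * Real.sqrt (2 + u / B) := by
      rw [hsdef, ← Real.sqrt_mul hN0.le]
      exact Real.sqrt_le_sqrt hNM
    have hmain : (M : ℝ) * Real.log (1 + x) ≤ C * (s * Real.sqrt (2 + u / B)) + c * s := by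
      have := mul_le_mul_of_nonneg_left hsqrtNM hC
      rw [hx]; linarith
    have hMy' : u * N / (4 * B) ≤ M := by
      have e : y / 2 = u * N / (4 * B) := by rw [hy]; exact aux2 u N B hB0
      linarith
    rcases le_or_gt 1 x with hx1 | hx1
    · -- large deviation `u ≥ 2μ²`
      have hu2 : 2 * μ ^ 2 ≤ u := by
        rw [hx, le_div_iff₀ (by positivity)] at hx1; linarith
      have hμ2 : 1 ≤ μ ^ 2 := one_le_pow₀ hμ
      have hu1 : 1 ≤ u := by linarith
      set w : ℝ := Real.sqrt u with hw
      have hw1 : 1 ≤ w := by rw [hw, ← Real.sqrt_one]; exact Real.sqrt_le_sqrt hu1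
      have hw0 : 0 < w := by linarith
      have hwu : w ^ 2 = u := by rw [hw]; exact Real.sq_sqrt hu.le
      have hsq2 : Real.sqrt (2 + u / B) ≤ 2 + w := by
        rw [Real.sqrt_le_left (by linarith)]
        have h1 : u / B ≤ u := div_le_self hu.le hB1
        have h2 : (2 + w) ^ 2 = 4 + 4 * w + u := by rw [← hwu]; ring
        rw [h2]; linarith
      have hlog : (1 : ℝ) / 2 ≤ Real.log (1 + x) := half_le_log_one_add' hx1
      have h1 : (M : ℝ) / 2 ≤ C * (s * (2 + w)) + c * s := by
        have h2 : (M : ℝ) * (1 / 2) ≤ (M : ℝ) * Real.log (1 + x) := mul_le_mul_of_nonneg_left hlog (by positivity)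
        have h3 : C * (s * Real.sqrt (2 + u / B)) ≤ C * (s * (2 + w)) :=
          mul_le_mul_of_nonneg_left (mul_le_mul_of_nonneg_left hsq2 hs0.le) hC
        linarith
      have h2 : u * N / (8 * B) ≤ C₂ * s * w := by
        have h3 : u * N / (8 * B) ≤ (M : ℝ) / 2 := by
          have e : u * N / (8 * B) = u * N / (4 * B) / 2 := by
            rw [div_div, show 4 * B * 2 = 8 * B by ring]
          rw [e]; linarith
        have h4 : C * (s * (2 + w)) + c * s ≤ C₂ * s * w := by
          rw [hC₂]
          have h5 : 0 ≤ s * (w - 1) := mul_nonneg hs0.le (by linarith)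
          have h6 : 0 ≤ C * (s * (w - 1)) := mul_nonneg hC h5
          have h7 : 0 ≤ c * (s * (w - 1)) := mul_nonneg hc h5
          have h8 : 0 ≤ s * w := by positivity
          -- `(1/2 + 3C + c) s w - C s (2 + w) - c s = (1/2) s w + 2 C (s w - s) + c (s w - s) ≥ 0`
          have e : (1 / 2 + 3 * C + c) * s * w - (C * (s * (2 + w)) + c * s) =
              (1 / 2) * (s * w) + 2 * (C * (s * (w - 1))) + c * (s * (w - 1)) := by ring
          linarith [e]
        linarith
      have h3 : w * s ≤ 8 * B * C₂ := by
        rw [← hwu, ← hsN] at h2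
        rw [div_le_iff₀ (by positivity)] at h2
        have hws : 0 < w * s := mul_pos hw0 hs0
        have e : w ^ 2 * s ^ 2 = (w * s) * (w * s) := by ring
        rw [e] at h2
        have h8 : (w * s) * (w * s) ≤ (w * s) * (8 * B * C₂) := by linarith
        exact le_of_mul_le_mul_left h8 hws
      have h4 : u * N ≤ K₁ := by
        rw [← hwu, ← hsN, hK₁]
        have : w ^ 2 * s ^ 2 = (w * s) ^ 2 := by ring
        rw [this]
        exact pow_le_pow_left₀ (by positivity) h3 2
      have h5 : u * t ≤ K₁ := by
        have e : u * N = u * t * t ^ 3 := by rw [← ht4]; ring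
        rw [e] at h4
        have ht3 : 1 ≤ t ^ 3 := one_le_pow₀ ht1
        have h6 : u * t * 1 ≤ u * t * t ^ 3 := mul_le_mul_of_nonneg_left ht3 hut0
        linarith
      exact h5.trans hK₁le
    · -- small deviation `u < 2μ²`: `log(1+x) ≥ x/2`, `√(2+u/B) ≤ 2μ`
      have hlog : x / 2 ≤ Real.log (1 + x) := half_le_log_one_add hx0.le hx1.le
      have hu2 : u ≤ 2 * μ ^ 2 := by
        rw [hx, div_lt_one (by positivity)] at hx1; linarith
      have hsq2 : Real.sqrt (2 + u / B) ≤ 2 * μ := by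
        rw [Real.sqrt_le_left (by linarith)]
        have h1 : u / B ≤ u := div_le_self hu.le hB1
        have hμ2 : 1 ≤ μ ^ 2 := one_le_pow₀ hμ
        have e : (2 * μ) ^ 2 = 4 * μ ^ 2 := by ring
        rw [e]; linarith
      have h1 : (M : ℝ) * x ≤ C₃ * s := by
        have h2 : (M : ℝ) * (x / 2) ≤ (M : ℝ) * Real.log (1 + x) := mul_le_mul_of_nonneg_left hlog (by positivity)
        have h3 : C * (s * Real.sqrt (2 + u / B)) ≤ C * (s * (2 * μ)) :=
          mul_le_mul_of_nonneg_left (mul_le_mul_of_nonneg_left hsq2 hs0.le) hC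
        rw [hC₃]; linarith
      have h2 : u ^ 2 * N ≤ K₂ * s := by
        have h3 : u * N / (4 * B) * x ≤ C₃ * s := le_trans (mul_le_mul_of_nonneg_right hMy' hx0.le) h1
        rw [hx, aux1 u N B μ hB0 hμ0, div_le_iff₀ (by positivity)] at h3
        rw [hK₂]; linarith
      have h3 : (u * t) ^ 2 ≤ K₂ := by
        rw [← hsN] at h2
        have e : s ^ 2 = s * s := sq s
        rw [e, ← mul_assoc] at h2
        have h4 := le_of_mul_le_mul_right h2 hs0
        rw [hsqrt] at h4
        have e2 : (u * t) ^ 2 = u ^ 2 * t ^ 2 := by ring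
        rw [e2]; exact h4
      have hK₂1 : 1 ≤ max 1 K₂ := le_max_left _ _
      have := le_of_pow_le' (k := 2) (by norm_num) hut0 hK₂1 (h3.trans (le_max_right _ _))
      exact this.trans (max_le hK1 hK₂le)

end KestenRateUpper

end Literature.Probability.RandomPlanarGeometry.SAW.Zd
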